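import Literature.MathematicalPhysics.QuantumFieldTheory.Balaban1983to89.B9SectBCodedFamiliesUParH

/-!
# `Balaban1983to89.B9SectBH1StepUParH` — T. Bałaban, *Propagators for lattice gauge theories in a background field*, Commun. Math. Phys. **99** (1985) 389–434
# [Balaban1985BackgroundPropagators], Thm 3.4 p. 400 with (3.43) p. 398, (3.40) p. 397 («`Γ_{x,x′}` a shortest contour») and (3.21) p. 394 (the averaging contours of
# `Q′(U)`): THE (3.43) MEMBER OF THE SECT.-B STEP FOR THE TWO-TRANSPORTER CODED READING `KSCUPar parA parH` — the Hölder transfer re-threaded with the operator at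
# `parA` and the Hölder quotients at `parH` (pub-ymgap N06 [B9]; CASCADE-K step K1, the (C) road, module F2)

statement-level skeleton of published theorems with citation tags; proofs where landed; nothing here is a claim about the Yang–Mills mass gap

THE PRINT.  (3.43) p. 398: `‖ζ∇_U G′(U)λ‖_β, ‖ζG′(U)∇*_Uλ‖_β ≦ B₀(β)(Lʲη)^{1−β}(…)e^{−δ₀d(y,y′)}|λ|` with the Hölder quotients of (3.40) p. 397 transported along «a shortest
contour» `Γ_{x,x′}`; `G′(U) = (Δ′_a(U))⁻¹` is built from the block averaging `Q′(U)` whose contours `Γ_{y,x}` are those of (3.21) p. 394.  Sect. B (p. 402 after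
(3.64), p. 403 l. 1–9) transports (3.43) from `U` to `U′U` («of course with different constants»).

WHY THIS FILE (pub-ymgap node N06 [B9]; director-ym №383 CASCADE-K, K1 := this seat's lineage; node00-def-Y's RULING on ⚑ FLAG K1-PAR; module F2 of the (C) road
I.19389).  The tree's (3.43) member of the Sect.-B step of record is `B9SectBH1FrameCodedY(R).stepH1Pos_KSCU_on` for the single-transporter reading `KSCU par`, whose
core is the 320-line transfer `h1_transfer_KSC₅` (dag-n06-c g11).  In that proof the transporter `par` plays the two printed roles at once: inside the operator letters
(`GpY par`, `GopC par` — (3.21)'s averaging contours) and inside the Hölder probes (`probeH (par U)`, `quotS (par U)`, `h1ReadT … (par U)`, the unit-norm law `hpar`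
and the transporter law `HolderLipY c_Lip (par U) U` — (3.40)'s shortest contours).  The probe toolkit underneath (`B9SectBH1ProbesY.quotL∕R_blockSupp_le`,
`B9SectBH1FrameCodedY.probe_undiff_le ∕ probe_cross_le`, `B9SectBH1ReadWriteY.h1ReadT_le_of_probes`) already takes the operator `T` and the transporter separately, so
the proof re-threads VERBATIM with the roles separated.  THIS FILE:
* §1 ★★ `h1_transfer_KSC₇Par` — the transfer field of the (3.43) frame for the two-transporter frame family `B9SectBCodedFamiliesUParH.KSC₇Par parA parH`: g11's proof
  with `GpY ∕ GopC ∕ letters_base_of_gVal` at `parA` and `probeH ∕ quotS ∕ h1ReadT ∕ hparH ∕ HolderLipY ∕ probe_undiff_le ∕ probe_cross_le` at `parH`;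
* §2 ★ `h1Frame₃CodedOnPar` (the `H1Frame₃` over the coded carriers of a subfamily: root frame `gpFrame₂CodedOn` at `parA` + `wH5` + §1), ★ `stepH1Pos_KSC₇Par_on`
  (`stepH1Pos_of_h1Frame₃`), ★★★ `stepH1Pos_KSCUPar_on` — THE (3.43) MEMBER OF THE SECT.-B STEP OF RECORD FOR `(KSCUPar parA parH, KACU, C⁻¹)` (input transport
  `B9SectBCodedFamiliesUParH.hin_KSCUPar_on_pos`, identity output `h1Block_KSC₇Par_iff`; the neighbour count above its own threshold), DISPLAYING beyond the root
  frame's data (`hpar hunit hC37` at `parA`): `hparH` (the Hölder transporters take values in `G`) and `hLip` (`Reg335 ⇒ HolderLipY c_Lip (parH U) U`);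
* §3 ★★ `stepH1Pos_KSCUPar_parSymYH_on` — the Hölder transporter of record `parH := parSymY` (print's shortest = taxicab contours): `hparH` by `Node00.parSymY_mem`,
  `hLip` by `B9Eq340HolderLipParSymY(R).hLip_parSymY` (`c_Lip = d+1`); the AVERAGING transporter `parA` stays a parameter with its laws displayed — exactly the shape
  the knit instance `(parA, parH) := (parKnitY, parSymY)` needs (`HolderLipY c (parKnitY U) U` is NOT a law of the class, ⚑ FLAG K1-PAR I.19099).

HONEST SCOPE ∕ NOT CLAIMED.  A re-threading of a landed proof at separated transporter roles + its frame instance and two transported step theorems; every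
displayed law is a hypothesis (§3 discharges the two `parH`-laws at `parSymY` by landed lemmas); nothing of [B9]'s analysis is asserted beyond what g11's proof and
r06's uniform Hölder transfers prove; count-neutral; N06 NOT discharged; nothing continuum ∕ OS ∕ mass gap ∕ Clay.  NEW file; no `sorry`, no `axiom`, no `instance`, no
`notation`; one `noncomputable def` (the frame instance).  Cell `pub-ymgap` (D-0062), seat `pub-ymgap-dag-n06-c` (gen 24), 2026-08-30; `--supports stmt-QuantumFields-27364`.
Net new unproved facts: 0.

RELATED IN THE TREE, NOT DUPLICATED (searched 2026-08-30: `rg 'h1_transfer_KSC₇Par|h1Frame₃CodedOnPar|stepH1Pos_KSCUPar' lean/Literature lean/Summits` — 0 hits):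
`B9SectBH1FrameCodedY(R)` (`h1_transfer_KSC₅`, `h1Frame₃CodedOn`, `stepH1Pos_KSCU_on` — the diagonal instance `parA = parH`; its tools `wH5`, `probe_undiff_le`,
`probe_cross_le`, `len_blkC_eq`, `pow_level_mul_etaS_le_one` USED), `B9Eq340HolderLipParSymY(R)` (`hLip_parSymY`, `stepH1Pos_KSCU_parSymY_on`, USED ∕ twinned),
`B9SectBCodedFamiliesUParH` (`KSC₇Par`, `hin_KSCUPar_on_pos`, USED).
-/

noncomputable section

namespace Literature.MathematicalPhysics.QuantumFieldTheory.Balaban1983to89.B9SectBH1StepUParH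

open Literature.MathematicalPhysics.QuantumFieldTheory.Balaban1983to89.B9SectBCodedClassR (RegExtraY bg9YC)
open Literature.MathematicalPhysics.QuantumFieldTheory.Balaban1983to89.B9SectBCodedFamiliesUParH
open B6RandomWalk (HasMajorant hasMajorant_mono BlockSupp)
open B6KLevelCensusIndexV1 (KIdx kGeo)
open B6Ineq2142KLevelV1 (β beta_level)
open B6Prop22KLevelTorusCensusEta (nKT nKT_pos hqTP hqTP_nonneg lenT_le_one geoTP_len)
open B9Thm34Ext (toB6)
open B9FromB6 (EBlock H1Block)
open B9Eq352DivFormLetters (conj coordEquiv gradLetterF gradLetterB)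
open B9Eq352GradLetters (diffLetter diffLetter_inl diffLetter_inr)
open B9Thm34SectBUniformR1 (thm34_Gp_uniform)
open B9Thm34HolderGpUniformR1 (thm34_Gp_holderLeft_uniform thm34_Gp_holderRight_uniform)
open B9SectBGpStepAtLettersV2 (GpFrame₂)
open B9SectBStepWhole (StepPos StepH1Pos)
open B9SectBCodedCarrier (CCfg Coding pullK pullS)
open B9Eq360DeltaPrimeAY (AfldY blkY)
open B9PinMembersKLevelV1 (MemberY geo9Y bg9Y)
open B9SectBGpLettersY (GVal decY coordC blkC GopC letters_base_of_gVal norm_le_one_and_inv_of_mem stencil0_geo9K)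
open B9SectBGpFrameCodedYR (codingYx Read342Y Write342Y)
open B9SectBGpFrameCodedY (CplxLettersY)
open B9SectBGpReadingsYR (KSC read342Y_KSC write342Y_KSC)
open B9SectBGpReadingsY (baseY etaS_eq_eta)
open B9SectBCodedReadingsUR (KSCU KACU)
open B9SectBCodedReadingsUParH (KSCUPar)
open B9SectBStepsKSCUR (KACU_members_base ineq342_346_347_congr thms_KSCU_base_iff hin_KSCU_on_pos)
open B9SectBGpTransferInYR (ineq343_345_congr)
open B9SectBCodedChainOnSubfamilyR (gpFrame₂CodedOn)
open B9SectBStepPosFamilyTransfer (stepH1Pos_of_family_pos)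
open B9RWSumsReadsNbr (nbr mem_nbr)
open B9GeoNbrCountKLevelV1 (exists_card_nbr_geo9Y_le_of_M)
open B9GeoLemma21KLevelV1 (geo9Y_dist_triangle geo9Y_len_pos)
open B9RWSums347DefiniteFacesWindow (geo9Y_dist_nonneg)
open B9GeoNormsKLevelModelSignsV1 (modelSignsOn_geo9K)
open Node00 (SiteY BlkY IBondY CfgY BallY SiteParY BondParY BondOpY liftY deltaPrimeAY kernelFamilyS GpY UboxY shiftY etaS cdS cdsS cdS_smul toKT parSymY parSymY_mem)
open Node00.OpsYRead342 (geo9K_len_congr geo9K_dist_congr)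
open B9Ineq349SiteComposite (cdSL cdsSL cdSL_apply cdsSL_apply etaS_pos supBlkS'_le)
open B9SectBH1ReadWriteY (wordS quotS h1ReadT quotS_nonneg h1ReadT_le_of_probes)
open B9SectBH1ProbesY (probeH probeH_apply norm_probeH quotS_wordS_eq Gsc symm_conj_G symm_gradF_G symm_G_negGradB symm_G_gradF cutH_inl_nonneg
  cutH_inl_eq HolderLipY quot_undiff_le quotL_blockSupp_le quotR_blockSupp_le quotRF_cross_symm_le norm_symm_apply_le_of_hasMajorant
  blockSupp_coordEquiv_liftY)
open B9SectBH1FrameCodedY (H1Frame₃ stepH1Pos_of_h1Frame₃ wH5 wH5_nonneg probe_undiff_le probe_cross_le len_blkC_eq pow_level_mul_etaS_le_one)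
open B9Eq340HolderLipParSymYR (hLip_parSymY)

variable {d ℓ : ℕ} {hd : 1 ≤ d + 1} {hL : Odd (ℓ + 1) ∧ 1 < ℓ + 1} {b₀ b₁ : ℝ} {Mstar : ℕ}
variable {𝔸 : Type} [NormedRing 𝔸] (P : RegExtraY d ℓ hd hL b₀ b₁ Mstar 𝔸) [NormedAlgebra ℂ 𝔸] [CompleteSpace 𝔸] [FiniteDimensional ℝ 𝔸]

/-! ## §1 ★★ The transfer field of the (3.43) frame PROVED for `KSC₇Par parA parH` -/

section Transfer

variable [NormOneClass 𝔸] (c35 : ℝ) (G : Subgroup 𝔸ˣ) (x : MemberY d ℓ hd hL b₀ b₁ Mstar) (parA parH : SiteParY 𝔸 x.toKIdx) {ι : Type} [Fintype ι]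
  (b : Module.Basis ι ℝ 𝔸) (ιB : BlkY x.toKIdx → IBondY x.toKIdx) [Fintype (geo9Y x).Site]
  (C37 C38 : ℝ → CfgY 𝔸 x.toKIdx → AfldY 𝔸 x.toKIdx → Prop)

omit [FiniteDimensional ℝ 𝔸] in
set_option maxHeartbeats 800000 in
/-- ★★ **THE TRANSFER FIELD OF THE (3.43) FRAME, PROVED FOR THE TWO-TRANSPORTER FAMILY `KSC₇Par parA parH`** (dag-n06-c g11's proof of
`B9SectBH1FrameCodedY.h1_transfer_KSC₅`, re-threaded with the two printed transporter roles SEPARATED: the operator letters `GopC ∕ GpY` at the AVERAGING transporter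
`parA` ((3.21) p.394), the Hölder probes `probeH ∕ quotS ∕ h1ReadT`, the unit-norm law `hparH` and the transporter law `HolderLipY` at the HÖLDER transporter `parH`
((3.40) p.397, «`Γ_{x,x′}` a shortest contour»)): from r06's per-probe left and right Hölder transfers for the letters of the member (hypotheses `HL`, `HR`, the
shapes of `H1Frame₃.h1_transfer`, letters at `parA`), the (3.42) majorants at the base (`hread`), the (3.42)∕(3.43) blocks of `KSC₇Par` at the base, the law
`HolderLipY c_Lip (parH U) U` at the regular base and the neighbour count: the (3.43) block of `KSC₇Par` at the coded product with `(wH5 … B₀ B_L B_R δc Bβ, 9δc∕10)`.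
[cite: Balaban1985BackgroundPropagators, Thm 3.4 p.400, (3.43) p.398, (3.40) p.397, p.403 l.1–9, (3.60)–(3.65) pp.402–403; Balaban1984PropagatorsII, (2.51)–(2.52) p.232, Lemma 2.1 p.234] -/
theorem h1_transfer_KSC₇Par (hι : ∀ s : BlkY x.toKIdx, β x.toKIdx.hN x.toKIdx.D x.toKIdx.hk (ιB s) = s)
    (hG1 : ∀ u : 𝔸ˣ, u ∈ G → ‖(u : 𝔸)‖ ≤ 1) (hparH : ∀ U : CfgY 𝔸 x.toKIdx, GVal G x.toKIdx U → ∀ z w, parH U z w ∈ G)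
    {M₂ : ℝ} (hM₂ : 0 ≤ M₂) (hrepr : ∀ (v : 𝔸) (j : ι), |b.repr v j| ≤ M₂ * ‖v‖)
    {cLip : ℝ} (hcLip : 0 ≤ cLip) (hLip : ∀ (α₀ : ℝ) (U : CfgY 𝔸 x.toKIdx), (bg9YC 𝔸 G P x).Reg335 c35 α₀ U → HolderLipY x.toKIdx cLip (parH U) U)
    {MInv : ℝ} {mN : ℕ} (hnbr : MInv ≤ (geo9Y x).M → ∀ y' : IBondY x.toKIdx, (nbr (geo9Y x) (2 * ((d : ℝ) + 1)) y').card ≤ mN)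
    {cR aInv aW : ℝ} (hcR : 0 < cR) (hread : Read342Y P G x parA b ιB C37 C38 (KSC₇Par P G x parA parH C37 C38) c35 cR MInv aInv 0 True)
    (α₀ : ℝ) (c c' : (codingYx P G x C37 C38).bg.Cfg) (α₁ B₀ BL BR δ δc : ℝ) (Bβ : ℝ → ℝ)
    (hM : MInv ≤ (geo9Y x).M) (hα₀ : 0 < α₀) (hMa : (geo9Y x).M * α₀ ≤ aInv) (hreg : (codingYx P G x C37 C38).bg.Reg335 c35 α₀ c)
    (_hα₁ : 0 < α₁) (_haW : α₁ ≤ aW) (h37 : (codingYx P G x C37 C38).bg.Cplx337 α₁ c c') (hB₀ : 0 < B₀) (hBL : 0 ≤ BL) (hBR : 0 ≤ BR)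
    (hδ : 0 < δ) (hδc : 0 < δc) (hδcδ : δc ≤ δ)
    (hE : EBlock (KSC₇Par P G x parA parH C37 C38) B₀ δ c) (hH1 : H1Block (KSC₇Par P G x parA parH C37 C38) Bβ δ c)
    (HL : ∀ (D : Module.End ℝ (SiteY x.toKIdx × ι → ℝ)) (Φ : (SiteY x.toKIdx → 𝔸) →ₗ[ℝ] 𝔸) (y : IBondY x.toKIdx) (p₀ : SiteY x.toKIdx × ι),
      blkC x.toKIdx ιB p₀.1 = y → ∀ (β Bh cζ : ℝ), 0 ≤ Bh → 0 ≤ cζ →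
        (∀ (y' : IBondY x.toKIdx) (μ : SiteY x.toKIdx × ι → ℝ) (M : ℝ),
          BlockSupp (g := toB6 (geo9Y x) (0 : ℝ) True) (fun p : SiteY x.toKIdx × ι => blkC x.toKIdx ιB p.1) μ y' M →
          ‖Φ ((coordEquiv b).symm (D (GopC x.toKIdx parA b c μ)))‖ ≤
            Bh * (geo9Y x).len y ^ (1 - β) * cζ * Real.exp (-(δc * (geo9Y x).dist y y')) * M) →
        ∀ (y' : IBondY x.toKIdx) (μ : SiteY x.toKIdx × ι → ℝ) (M : ℝ),
          BlockSupp (g := toB6 (geo9Y x) (0 : ℝ) True) (fun p : SiteY x.toKIdx × ι => blkC x.toKIdx ιB p.1) μ y' M →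
          ‖Φ ((coordEquiv b).symm (D (GopC x.toKIdx parA b ((codingYx P G x C37 C38).bg.mul c' c) μ)))‖ ≤
            BL * Bh * (geo9Y x).len y ^ (1 - β) * cζ * Real.exp (-(9 / 10 * δc * (geo9Y x).dist y y')) * M)
    (HR : ∀ (D : Module.End ℝ (SiteY x.toKIdx × ι → ℝ)),
      HasMajorant (g := toB6 (geo9Y x) (0 : ℝ) True) (fun p : SiteY x.toKIdx × ι => blkC x.toKIdx ιB p.1) (GopC x.toKIdx parA b c * D)
        (fun a a' => cR * B₀ * (geo9Y x).len a * Real.exp (-(δc * (geo9Y x).dist a a'))) →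
      ∀ (Φ : (SiteY x.toKIdx → 𝔸) →ₗ[ℝ] 𝔸) (y : IBondY x.toKIdx) (p₀ : SiteY x.toKIdx × ι), blkC x.toKIdx ιB p₀.1 = y →
      ∀ (β Bh cζ : ℝ), 0 ≤ Bh → 0 ≤ cζ →
        (∀ (y' : IBondY x.toKIdx) (μ : SiteY x.toKIdx × ι → ℝ) (M : ℝ),
          BlockSupp (g := toB6 (geo9Y x) (0 : ℝ) True) (fun p : SiteY x.toKIdx × ι => blkC x.toKIdx ιB p.1) μ y' M →
          ‖Φ ((coordEquiv b).symm (GopC x.toKIdx parA b c μ))‖ ≤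
            Bh * (geo9Y x).len y ^ (2 - β) * cζ * Real.exp (-(δc * (geo9Y x).dist y y')) * M) →
        (∀ (k : Fin (d + 1) ⊕ Fin (d + 1)) (y' : IBondY x.toKIdx) (μ : SiteY x.toKIdx × ι → ℝ) (M : ℝ),
          BlockSupp (g := toB6 (geo9Y x) (0 : ℝ) True) (fun p : SiteY x.toKIdx × ι => blkC x.toKIdx ιB p.1) μ y' M →
          ‖Φ ((coordEquiv b).symm
              ((GopC x.toKIdx parA b c * conj b (diffLetter (shiftY x.toKIdx) (coordC G x.toKIdx c) ((((geo9Y x).eta : ℂ))⁻¹) k)) μ))‖ ≤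
            Bh * (geo9Y x).len y ^ (1 - β) * cζ * Real.exp (-(δc * (geo9Y x).dist y y')) * M) →
        (∀ (y' : IBondY x.toKIdx) (μ : SiteY x.toKIdx × ι → ℝ) (M : ℝ),
          BlockSupp (g := toB6 (geo9Y x) (0 : ℝ) True) (fun p : SiteY x.toKIdx × ι => blkC x.toKIdx ιB p.1) μ y' M →
          ‖Φ ((coordEquiv b).symm ((GopC x.toKIdx parA b c * D) μ))‖ ≤
            Bh * (geo9Y x).len y ^ (1 - β) * cζ * Real.exp (-(δc * (geo9Y x).dist y y')) * M) →
        ∀ (y' : IBondY x.toKIdx) (μ : SiteY x.toKIdx × ι → ℝ) (M : ℝ),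
          BlockSupp (g := toB6 (geo9Y x) (0 : ℝ) True) (fun p : SiteY x.toKIdx × ι => blkC x.toKIdx ιB p.1) μ y' M →
          ‖Φ ((coordEquiv b).symm ((GopC x.toKIdx parA b ((codingYx P G x C37 C38).bg.mul c' c) * D) μ))‖ ≤
            BR * Bh * (geo9Y x).len y ^ (1 - β) * cζ * Real.exp (-(9 / 10 * δc * (geo9Y x).dist y y')) * M) :
    H1Block (KSC₇Par P G x parA parH C37 C38) (wH5 (2 * ((d : ℝ) + 1)) (∑ j, ‖b j‖) M₂ cR cLip mN B₀ BL BR δc Bβ) (9 / 10 * δc)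
      ((codingYx P G x C37 C38).bg.mul c' c) := by
  classical
  letI : Fintype (B9GeoNormsKLevelV1.geo9K x.toKIdx).Site := ‹Fintype (geo9Y x).Site›
  -- the coded pair is (base U, mult a); the product is `prod U a`
  obtain ⟨U, a, rfl, rfl, hCa⟩ := (codingYx P G x C37 C38).exists_of_bg_Cplx337 h37
  have hU335 : (bg9YC 𝔸 G P x).Reg335 c35 α₀ U := by
    obtain ⟨U', h1, h2⟩ := (codingYx P G x C37 C38).exists_of_bg_Reg335 hreg
    cases h1
    exact h2
  have hU : GVal G x.toKIdx U := hU335.1.1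
  -- notation and elementary facts
  set Sb : ℝ := ∑ j, ‖b j‖ with hSb
  have hSb0 : 0 ≤ Sb := Finset.sum_nonneg fun j _ => norm_nonneg _
  set TU : (SiteY x.toKIdx → 𝔸) →ₗ[ℂ] (SiteY x.toKIdx → 𝔸) := GpY x.toKIdx parA U with hTU
  set TW : (SiteY x.toKIdx → 𝔸) →ₗ[ℂ] (SiteY x.toKIdx → 𝔸) := GpY x.toKIdx parA (decY x.toKIdx (.prod U a)) with hTW
  have hη : 0 < etaS x.toKIdx := etaS_pos x.toKIdx
  have hco : coordC G x.toKIdx (.base U) = UboxY x.toKIdx U := (letters_base_of_gVal G x.toKIdx parA hU).1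
  have hGopU : GopC x.toKIdx parA b (.base U) = conj b (Gsc x.toKIdx TU) := by
    show conj b (((kGeo x.toKIdx).eta ^ 2) • (GpY x.toKIdx parA U).restrictScalars ℝ) = conj b ((etaS x.toKIdx ^ 2) • TU.restrictScalars ℝ)
    rw [etaS_eq_eta]
  have hGopW : GopC x.toKIdx parA b ((codingYx P G x C37 C38).bg.mul (.mult a) (.base U)) = conj b (Gsc x.toKIdx TW) := by
    show conj b (((kGeo x.toKIdx).eta ^ 2) • (GpY x.toKIdx parA (decY x.toKIdx (.prod U a))).restrictScalars ℝ) = conj b ((etaS x.toKIdx ^ 2) • TW.restrictScalars ℝ)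
    rw [etaS_eq_eta]
  have hDk : ∀ k : Fin (d + 1) ⊕ Fin (d + 1),
      diffLetter (shiftY x.toKIdx) (coordC G x.toKIdx (.base U)) ((((geo9Y x).eta : ℂ))⁻¹) k = diffLetter (shiftY x.toKIdx) (UboxY x.toKIdx U) ((((etaS x.toKIdx : ℝ) : ℂ))⁻¹) k := by
    intro k
    show diffLetter (shiftY x.toKIdx) (coordC G x.toKIdx (.base U)) ((((kGeo x.toKIdx).eta : ℝ) : ℂ))⁻¹ k = _
    rw [hco, etaS_eq_eta]
  have hUu : ∀ (μ : Fin (d + 1)) (w : SiteY x.toKIdx), ‖((UboxY x.toKIdx U μ w : 𝔸ˣ) : 𝔸)‖ ≤ 1 ∧ ‖(((UboxY x.toKIdx U μ w)⁻¹ : 𝔸ˣ) : 𝔸)‖ ≤ 1 :=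
    fun μ w => norm_le_one_and_inv_of_mem G hG1 (hU μ _)
  have hparU : ∀ z w : SiteY x.toKIdx, ‖((parH U z w : 𝔸ˣ) : 𝔸)‖ ≤ 1 ∧ ‖(((parH U z w)⁻¹ : 𝔸ˣ) : 𝔸)‖ ≤ 1 :=
    fun z w => norm_le_one_and_inv_of_mem G hG1 (hparH U hU z w)
  have hLipU : HolderLipY x.toKIdx cLip (parH U) U := hLip α₀ U hU335
  have hnbrU := hnbr hM
  have hdd : 0 ≤ 2 * ((d : ℝ) + 1) := by positivity
  -- the (3.42) majorants of the letters at the base (rate δ)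
  obtain ⟨hm0, hm1, hm2, -⟩ := hread α₀ U B₀ δ hM hα₀ hMa hU335 hB₀ hδ hE
  have hm1' : ∀ ν : Fin (d + 1), HasMajorant (g := toB6 (geo9Y x) (0 : ℝ) True) (fun p : SiteY x.toKIdx × ι => blkC x.toKIdx ιB p.1)
      (conj b (gradLetterF (shiftY x.toKIdx) (UboxY x.toKIdx U) ((((etaS x.toKIdx : ℝ) : ℂ))⁻¹) ν) * conj b (Gsc x.toKIdx TU))
      (fun a a' => cR * B₀ * (geo9Y x).len a * Real.exp (-(δ * (geo9Y x).dist a a'))) := by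
    intro ν
    have h := hm1 (Sum.inl ν)
    rwa [hDk, diffLetter_inl, hGopU] at h
  -- the output block
  intro α lam ζ y y' hα0 hα1 hζ hlam
  have hW5 : 0 ≤ wH5 (2 * ((d : ℝ) + 1)) Sb M₂ cR cLip mN B₀ BL BR δc Bβ α :=
    wH5_nonneg mN Bβ hSb0 hM₂ hcR.le hcLip hB₀.le hBL hBR α
  have hleny : 0 < (geo9Y x).len y := geo9Y_len_pos x y
  have hcutH : 0 ≤ (geo9Y x).cutH α ζ := (modelSignsOn_geo9K x.toKIdx).cutH_nonneg α ζ
  have hsupN : 0 ≤ (geo9Y x).supNorm lam := (modelSignsOn_geo9K x.toKIdx).supNorm_nonneg lam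
  have hRHS : 0 ≤ wH5 (2 * ((d : ℝ) + 1)) Sb M₂ cR cLip mN B₀ BL BR δc Bβ α * (geo9Y x).len y ^ (1 - α) * (geo9Y x).cutH α ζ *
      Real.exp (-(9 / 10 * δc * (geo9Y x).dist y y')) * (geo9Y x).supNorm lam :=
    mul_nonneg (mul_nonneg (mul_nonneg (mul_nonneg hW5 (Real.rpow_nonneg hleny.le _)) hcutH) (Real.exp_pos _).le) hsupN
  -- only (site argument, site cut-off) is nontrivial
  rcases lam with f | J
  swap
  · rw [(KSC₇Par_h1_off P G x parA parH C37 C38 _ α).2 J ζ]; exact hRHS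
  rcases ζ with ζ₀ | zb
  swap
  · rw [(KSC₇Par_h1_off P G x parA parH C37 C38 _ α).1 f zb]; exact hRHS
  -- the U-letter reading of `G′(U′U)` at the base `U`
  rw [KSC₇Par_h1_inl]
  show h1ReadT x.toKIdx TW (parH U) U f α ζ₀ ≤ _
  have hζ' : ∀ w, ζ₀ w ≠ 0 → blkY x.toKIdx w = β x.toKIdx.hN x.toKIdx.D x.toKIdx.hk y := hζ
  -- trivial cut-off: every probe vanishes
  by_cases hζ0 : ∀ w, ζ₀ w = 0
  · refine h1ReadT_le_of_probes x.toKIdx TW (parH U) U f α ζ₀ hRHS (fun E μ z z' _ => ?_) (fun E μ z z' _ => ?_) <;>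
    · rw [quotS_wordS_eq, probeH_apply]
      simp only [hζ0, Complex.ofReal_zero, zero_smul, B9Eq39Adjoint.R_zero, sub_zero, smul_zero, norm_zero]
      exact hRHS
  push Not at hζ0
  obtain ⟨w₀, hw₀⟩ := hζ0
  -- the anchor: the labelled block of `w₀ ∈ supp ζ`
  set y₁ : IBondY x.toKIdx := blkC x.toKIdx ιB w₀ with hy₁
  have hy₁β : β x.toKIdx.hN x.toKIdx.D x.toKIdx.hk y₁ = β x.toKIdx.hN x.toKIdx.D x.toKIdx.hk y := by
    show β x.toKIdx.hN x.toKIdx.D x.toKIdx.hk (ιB (blkY x.toKIdx w₀)) = _; rw [hι, hζ' w₀ hw₀]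
  have hblk : ∀ w, blkY x.toKIdx w = β x.toKIdx.hN x.toKIdx.D x.toKIdx.hk y → blkC x.toKIdx ιB w = y₁ := by
    intro w hw; show ιB (blkY x.toKIdx w) = ιB (blkY x.toKIdx w₀); rw [hw, hζ' w₀ hw₀]
  have hlen : (geo9Y x).len y₁ = (geo9Y x).len y := geo9K_len_congr x.toKIdx hy₁β
  have hdist : ∀ t : IBondY x.toKIdx, (geo9Y x).dist y₁ t = (geo9Y x).dist y t := fun t => geo9K_dist_congr x.toKIdx hy₁β rfl
  set yL : IBondY x.toKIdx := ιB (β x.toKIdx.hN x.toKIdx.D x.toKIdx.hk y') with hyL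
  have hdistL : (geo9Y x).dist y₁ yL = (geo9Y x).dist y y' := geo9K_dist_congr x.toKIdx hy₁β (hι _)
  have hlen1 : (geo9Y x).len y₁ ≤ 1 := by rw [hy₁, len_blkC_eq x ιB hι]; exact pow_level_mul_etaS_le_one x _
  have hleny₁ : 0 < (geo9Y x).len y₁ := geo9Y_len_pos x y₁
  haveI : Nontrivial 𝔸 := NormOneClass.nontrivial
  obtain ⟨j₀⟩ := b.index_nonempty
  have hp₀ : blkC x.toKIdx ιB ((w₀, j₀) : SiteY x.toKIdx × ι).1 = y₁ := rfl
  -- constants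
  set cζ : ℝ := (geo9Y x).cutH α (Sum.inl ζ₀) with hcζ
  have hcζ0 : 0 ≤ cζ := hcutH
  have hcζeq : cζ = hqTP (toKT x.toKIdx) α ζ₀ + (toKT x.toKIdx).supF ζ₀ := cutH_inl_eq x.toKIdx α ζ₀
  set Bp : ℝ := max (Bβ α) 0 with hBp
  have hBp0 : 0 ≤ Bp := le_max_right _ _
  set BhL : ℝ := Sb * Bp with hBhL
  have hBhL0 : 0 ≤ BhL := mul_nonneg hSb0 hBp0
  set BhR : ℝ := Sb * (cR * B₀ * (1 + cLip) + Bp * (1 + (mN : ℝ) * (M₂ * Sb) * Real.exp (δc * (2 * ((d : ℝ) + 1))))) with hBhR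
  have hBhR0 : 0 ≤ BhR := by positivity
  -- the (3.43) block at the base, READ: reading bounds for scalar inputs supported in a block, at the call rate δc
  set Wf : IBondY x.toKIdx → ℝ := fun a' => Bp * (geo9Y x).len y₁ ^ (1 - α) * cζ * Real.exp (-(δc * (geo9Y x).dist y₁ a')) with hWf
  have hWf0 : ∀ a', 0 ≤ Wf a' := fun a' =>
    mul_nonneg (mul_nonneg (mul_nonneg hBp0 (Real.rpow_nonneg hleny₁.le _)) hcζ0) (Real.exp_pos _).le
  have hreadU : ∀ (g : SiteY x.toKIdx → ℝ) (a' : IBondY x.toKIdx), (geo9Y x).suppIn (Sum.inl g) a' →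
      h1ReadT x.toKIdx TU (parH U) U g α ζ₀ ≤ Wf a' * (geo9Y x).supNorm (Sum.inl g) := by
    intro g a' hg
    have h := hH1 α (Sum.inl g) (Sum.inl ζ₀) y a' hα0 hα1 hζ hg
    rw [KSC₇Par_h1_inl] at h
    have hN : 0 ≤ (geo9Y x).supNorm (Sum.inl g) := (modelSignsOn_geo9K x.toKIdx).supNorm_nonneg _
    refine (show h1ReadT x.toKIdx TU (parH U) U g α ζ₀ ≤ _ from h).trans ?_
    rw [← hlen, ← hdist]
    have hP : 0 ≤ (geo9Y x).len y₁ ^ (1 - α) * cζ := mul_nonneg (Real.rpow_nonneg hleny₁.le _) hcζ0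
    have hexp : Real.exp (-(δ * (geo9Y x).dist y₁ a')) ≤ Real.exp (-(δc * (geo9Y x).dist y₁ a')) :=
      Real.exp_le_exp.2 (by nlinarith [geo9Y_dist_nonneg x y₁ a'])
    calc Bβ α * (geo9Y x).len y₁ ^ (1 - α) * (geo9Y x).cutH α (Sum.inl ζ₀) * Real.exp (-(δ * (geo9Y x).dist y₁ a')) *
          (geo9Y x).supNorm (Sum.inl g)
        = Bβ α * (((geo9Y x).len y₁ ^ (1 - α) * cζ) * Real.exp (-(δ * (geo9Y x).dist y₁ a')) * (geo9Y x).supNorm (Sum.inl g)) := by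
          rw [hcζ]; ring
      _ ≤ Bp * (((geo9Y x).len y₁ ^ (1 - α) * cζ) * Real.exp (-(δc * (geo9Y x).dist y₁ a')) * (geo9Y x).supNorm (Sum.inl g)) := by
          refine mul_le_mul (le_max_left _ _) ?_ (mul_nonneg (mul_nonneg hP (Real.exp_pos _).le) hN) hBp0
          exact mul_le_mul_of_nonneg_right (mul_le_mul_of_nonneg_left hexp hP) hN
      _ = Wf a' * (geo9Y x).supNorm (Sum.inl g) := by rw [hWf]; ring
  -- the block support of the coordinates of the output input `f ⊗ E`
  have hBS : ∀ {E : 𝔸}, ‖E‖ ≤ 1 → BlockSupp (g := toB6 (geo9Y x) (0 : ℝ) True) (fun p : SiteY x.toKIdx × ι => blkC x.toKIdx ιB p.1)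
      (coordEquiv b (liftY f E)) yL (M₂ * (geo9Y x).supNorm (Sum.inl f)) := fun hE1 =>
    blockSupp_coordEquiv_liftY x.toKIdx b ιB hM₂ hrepr f y' hlam hE1
  ------------------------------------------------------------------
  -- LEFT WORDS: `ζη∇_{U,ν}G′(U′U)(f ⊗ E)`
  ------------------------------------------------------------------
  have hLeft : ∀ (E : BallY 𝔸) (ν : Fin (d + 1)) (z z' : SiteY x.toKIdx), z ≠ z' →
      quotS x.toKIdx (parH U) α (wordS x.toKIdx ζ₀ (cdSL x.toKIdx U ν ∘ₗ TW) (liftY f (E : 𝔸))) z z' ≤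
        BL * BhL * (geo9Y x).len y₁ ^ (1 - α) * cζ * Real.exp (-(9 / 10 * δc * (geo9Y x).dist y₁ yL)) * (M₂ * (geo9Y x).supNorm (Sum.inl f)) := by
    intro E ν z z' hne
    have hE1 : ‖(E : 𝔸)‖ ≤ 1 := mem_closedBall_zero_iff.1 E.2
    set D : Module.End ℝ (SiteY x.toKIdx × ι → ℝ) := conj b (gradLetterF (shiftY x.toKIdx) (UboxY x.toKIdx U) ((((etaS x.toKIdx : ℝ) : ℂ))⁻¹) ν) with hD
    set Φ : (SiteY x.toKIdx → 𝔸) →ₗ[ℝ] 𝔸 := probeH x.toKIdx (parH U) α ζ₀ z z' with hΦ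
    -- the premise at the base
    have prem : ∀ (y'' : IBondY x.toKIdx) (μ : SiteY x.toKIdx × ι → ℝ) (M : ℝ),
        BlockSupp (g := toB6 (geo9Y x) (0 : ℝ) True) (fun p : SiteY x.toKIdx × ι => blkC x.toKIdx ιB p.1) μ y'' M →
        ‖Φ ((coordEquiv b).symm (D (GopC x.toKIdx parA b (.base U) μ)))‖ ≤
          BhL * (geo9Y x).len y₁ ^ (1 - α) * cζ * Real.exp (-(δc * (geo9Y x).dist y₁ y'')) * M := by
      intro y'' μ M hμ
      calc ‖Φ ((coordEquiv b).symm (D (GopC x.toKIdx parA b (.base U) μ)))‖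
          = quotS x.toKIdx (parH U) α (wordS x.toKIdx ζ₀ (cdSL x.toKIdx U ν ∘ₗ TU) ((coordEquiv b).symm μ)) z z' := by
            rw [quotS_wordS_eq, hGopU, ← Module.End.mul_apply, hD, symm_gradF_G]; rfl
        _ ≤ Sb * (Wf y'' * M) := quotL_blockSupp_le x.toKIdx b ιB TU (parH U) U hι hM₂ hrepr α ζ₀ hWf0 hreadU hμ ν hne
        _ = BhL * (geo9Y x).len y₁ ^ (1 - α) * cζ * Real.exp (-(δc * (geo9Y x).dist y₁ y'')) * M := by rw [hWf, hBhL]; ring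
    have concl := HL D Φ y₁ (w₀, j₀) hp₀ α BhL cζ hBhL0 hcζ0 prem yL (coordEquiv b (liftY f (E : 𝔸))) _ (hBS hE1)
    calc quotS x.toKIdx (parH U) α (wordS x.toKIdx ζ₀ (cdSL x.toKIdx U ν ∘ₗ TW) (liftY f (E : 𝔸))) z z'
        = ‖Φ ((coordEquiv b).symm (D (GopC x.toKIdx parA b ((codingYx P G x C37 C38).bg.mul (.mult a) (.base U)) (coordEquiv b (liftY f (E : 𝔸))))))‖ := by
          rw [quotS_wordS_eq, hGopW, ← Module.End.mul_apply, hD, symm_gradF_G, LinearEquiv.symm_apply_apply]; rfl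
      _ ≤ _ := concl
  ------------------------------------------------------------------
  -- RIGHT WORDS: `ζηG′(U′U)∇*_{U,ν}(f ⊗ E)`
  ------------------------------------------------------------------
  have hRight : ∀ (E : BallY 𝔸) (ν : Fin (d + 1)) (z z' : SiteY x.toKIdx), z ≠ z' →
      quotS x.toKIdx (parH U) α (wordS x.toKIdx ζ₀ (TW ∘ₗ cdsSL x.toKIdx U ν) (liftY f (E : 𝔸))) z z' ≤
        BR * BhR * (geo9Y x).len y₁ ^ (1 - α) * cζ * Real.exp (-(9 / 10 * δc * (geo9Y x).dist y₁ yL)) * (M₂ * (geo9Y x).supNorm (Sum.inl f)) := by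
    intro E ν z z' hne
    have hE1 : ‖(E : 𝔸)‖ ≤ 1 := mem_closedBall_zero_iff.1 E.2
    -- the right letter IN THE FRAME's SYNTAX
    set D' : Module.End ℝ (SiteY x.toKIdx × ι → ℝ) := conj b (diffLetter (shiftY x.toKIdx) (coordC G x.toKIdx (.base U)) ((((geo9Y x).eta : ℂ))⁻¹) (Sum.inr ν))
      with hD'
    have hD'U : D' = conj b (-gradLetterB (shiftY x.toKIdx) (UboxY x.toKIdx U) ((((etaS x.toKIdx : ℝ) : ℂ))⁻¹) ν) := by rw [hD', hDk, diffLetter_inr]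
    set Φ : (SiteY x.toKIdx → 𝔸) →ₗ[ℝ] 𝔸 := probeH x.toKIdx (parH U) α ζ₀ z z' with hΦ
    -- (1) the (3.42)₃ majorant of `G′(U)D′` at the call rate
    have hmaj : HasMajorant (g := toB6 (geo9Y x) (0 : ℝ) True) (fun p : SiteY x.toKIdx × ι => blkC x.toKIdx ιB p.1) (GopC x.toKIdx parA b (.base U) * D')
        (fun a a' => cR * B₀ * (geo9Y x).len a * Real.exp (-(δc * (geo9Y x).dist a a'))) := by
      refine hasMajorant_mono _ (hm2 (Sum.inr ν)) fun a a' => ?_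
      refine mul_le_mul_of_nonneg_left (Real.exp_le_exp.2 (by nlinarith [geo9Y_dist_nonneg x a a'])) ?_
      exact mul_nonneg (mul_pos hcR hB₀).le (geo9Y_len_pos x a).le
    -- (2) the right-word premise at a backward letter (shared by (b′)-inr and (c′))
    have hbinr : ∀ (ν' : Fin (d + 1)) (y'' : IBondY x.toKIdx) (μ : SiteY x.toKIdx × ι → ℝ) (M : ℝ),
        BlockSupp (g := toB6 (geo9Y x) (0 : ℝ) True) (fun p : SiteY x.toKIdx × ι => blkC x.toKIdx ιB p.1) μ y'' M →
        ‖Φ ((coordEquiv b).symm ((GopC x.toKIdx parA b (.base U) *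
            conj b (diffLetter (shiftY x.toKIdx) (coordC G x.toKIdx (.base U)) ((((geo9Y x).eta : ℂ))⁻¹) (Sum.inr ν'))) μ))‖ ≤
          BhR * (geo9Y x).len y₁ ^ (1 - α) * cζ * Real.exp (-(δc * (geo9Y x).dist y₁ y'')) * M := by
      intro ν' y'' μ M hμ
      have hfac : 0 ≤ (geo9Y x).len y₁ ^ (1 - α) * cζ * Real.exp (-(δc * (geo9Y x).dist y₁ y'')) * M :=
        mul_nonneg (mul_nonneg (mul_nonneg (Real.rpow_nonneg hleny₁.le _) hcζ0) (Real.exp_pos _).le) hμ.nonneg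
      calc ‖Φ ((coordEquiv b).symm ((GopC x.toKIdx parA b (.base U) *
              conj b (diffLetter (shiftY x.toKIdx) (coordC G x.toKIdx (.base U)) ((((geo9Y x).eta : ℂ))⁻¹) (Sum.inr ν'))) μ))‖
          = quotS x.toKIdx (parH U) α (wordS x.toKIdx ζ₀ (TU ∘ₗ cdsSL x.toKIdx U ν') ((coordEquiv b).symm μ)) z z' := by
            rw [quotS_wordS_eq, hDk, diffLetter_inr, hGopU, symm_G_negGradB, map_neg, norm_neg]; rfl
        _ ≤ Sb * (Wf y'' * M) := quotR_blockSupp_le x.toKIdx b ιB TU (parH U) U hι hM₂ hrepr α ζ₀ hWf0 hreadU hμ ν' hne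
        _ = (Sb * Bp) * ((geo9Y x).len y₁ ^ (1 - α) * cζ * Real.exp (-(δc * (geo9Y x).dist y₁ y'')) * M) := by rw [hWf]; ring
        _ ≤ BhR * ((geo9Y x).len y₁ ^ (1 - α) * cζ * Real.exp (-(δc * (geo9Y x).dist y₁ y'')) * M) := by
            refine mul_le_mul_of_nonneg_right ?_ hfac
            rw [hBhR]
            refine mul_le_mul_of_nonneg_left ?_ hSb0
            have h1 : 0 ≤ cR * B₀ * (1 + cLip) := by positivity
            have h2 : Bp ≤ Bp * (1 + (mN : ℝ) * (M₂ * Sb) * Real.exp (δc * (2 * ((d : ℝ) + 1)))) :=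
              le_mul_of_one_le_right hBp0 (le_add_of_nonneg_right (by positivity))
            linarith
        _ = BhR * (geo9Y x).len y₁ ^ (1 - α) * cζ * Real.exp (-(δc * (geo9Y x).dist y₁ y'')) * M := by ring
    -- (3) premise (a′): the undifferentiated probe (`probe_undiff_le`)
    have hm0' : HasMajorant (g := toB6 (geo9Y x) (0 : ℝ) True) (fun p : SiteY x.toKIdx × ι => blkC x.toKIdx ιB p.1) (conj b (Gsc x.toKIdx TU))
        (fun a a' => cR * B₀ * (geo9Y x).len a ^ 2 * Real.exp (-(δ * (geo9Y x).dist a a'))) := by rw [← hGopU]; exact hm0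
    have prema : ∀ (y'' : IBondY x.toKIdx) (μ : SiteY x.toKIdx × ι → ℝ) (M : ℝ),
        BlockSupp (g := toB6 (geo9Y x) (0 : ℝ) True) (fun p : SiteY x.toKIdx × ι => blkC x.toKIdx ιB p.1) μ y'' M →
        ‖Φ ((coordEquiv b).symm (GopC x.toKIdx parA b (.base U) μ))‖ ≤
          BhR * (geo9Y x).len y₁ ^ (2 - α) * cζ * Real.exp (-(δc * (geo9Y x).dist y₁ y'')) * M := by
      intro y'' μ M hμ
      have h := probe_undiff_le x parH b ιB hι hcLip hLipU hparU TU (mul_pos hcR hB₀).le hδcδ hm0' hm1' hα0 hα1.le ζ₀ hζ' hw₀ hμ hne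
      rw [hGopU]
      refine h.trans ?_
      have hfac : 0 ≤ (geo9Y x).len y₁ ^ (2 - α) * cζ * Real.exp (-(δc * (geo9Y x).dist y₁ y'')) * M :=
        mul_nonneg (mul_nonneg (mul_nonneg (Real.rpow_nonneg hleny₁.le _) hcζ0) (Real.exp_pos _).le) hμ.nonneg
      have hle : Sb * (cR * B₀ * (1 + cLip)) ≤ BhR := by
        rw [hBhR]
        exact mul_le_mul_of_nonneg_left (le_add_of_nonneg_right (by positivity)) hSb0
      calc (Sb * (cR * B₀ * (1 + cLip))) * (geo9Y x).len y₁ ^ (2 - α) * cζ * Real.exp (-(δc * (geo9Y x).dist y₁ y'')) * M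
          = (Sb * (cR * B₀ * (1 + cLip))) * ((geo9Y x).len y₁ ^ (2 - α) * cζ * Real.exp (-(δc * (geo9Y x).dist y₁ y'')) * M) := by ring
        _ ≤ BhR * ((geo9Y x).len y₁ ^ (2 - α) * cζ * Real.exp (-(δc * (geo9Y x).dist y₁ y'')) * M) := mul_le_mul_of_nonneg_right hle hfac
        _ = _ := by ring
    -- (4) premise (b′): every letter `∇♯_k` on the right of `G′(U)` (forward letters through the CROSS read `probe_cross_le`)
    have premb : ∀ (k : Fin (d + 1) ⊕ Fin (d + 1)) (y'' : IBondY x.toKIdx) (μ : SiteY x.toKIdx × ι → ℝ) (M : ℝ),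
        BlockSupp (g := toB6 (geo9Y x) (0 : ℝ) True) (fun p : SiteY x.toKIdx × ι => blkC x.toKIdx ιB p.1) μ y'' M →
        ‖Φ ((coordEquiv b).symm ((GopC x.toKIdx parA b (.base U) *
            conj b (diffLetter (shiftY x.toKIdx) (coordC G x.toKIdx (.base U)) ((((geo9Y x).eta : ℂ))⁻¹) k)) μ))‖ ≤
          BhR * (geo9Y x).len y₁ ^ (1 - α) * cζ * Real.exp (-(δc * (geo9Y x).dist y₁ y'')) * M := by
      intro k y'' μ M hμ
      rcases k with ν' | ν'
      · have h := probe_cross_le x parH b ιB hι hM₂ hrepr hUu hnbrU TU α ζ₀ hBp0 hcζ0 hδc hreadU hμ ν' hne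
        rw [hDk, diffLetter_inl, hGopU]
        refine h.trans ?_
        have hfac : 0 ≤ (geo9Y x).len y₁ ^ (1 - α) * cζ * Real.exp (-(δc * (geo9Y x).dist y₁ y'')) * M :=
          mul_nonneg (mul_nonneg (mul_nonneg (Real.rpow_nonneg hleny₁.le _) hcζ0) (Real.exp_pos _).le) hμ.nonneg
        have hle : Sb * (Bp * ((mN : ℝ) * (M₂ * Sb) * Real.exp (δc * (2 * ((d : ℝ) + 1))))) ≤ BhR := by
          rw [hBhR]
          refine mul_le_mul_of_nonneg_left ?_ hSb0
          have h1 : 0 ≤ cR * B₀ * (1 + cLip) := by positivity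
          have h2 : Bp * ((mN : ℝ) * (M₂ * Sb) * Real.exp (δc * (2 * ((d : ℝ) + 1)))) ≤
              Bp * (1 + (mN : ℝ) * (M₂ * Sb) * Real.exp (δc * (2 * ((d : ℝ) + 1)))) :=
            mul_le_mul_of_nonneg_left (le_add_of_nonneg_left zero_le_one) hBp0
          linarith
        calc (∑ j, ‖b j‖) * (Bp * ((mN : ℝ) * (M₂ * ∑ j, ‖b j‖) * Real.exp (δc * (2 * ((d : ℝ) + 1))))) *
              ((geo9Y x).len y₁ ^ (1 - α) * cζ * Real.exp (-(δc * (geo9Y x).dist y₁ y'')) * M)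
            ≤ BhR * ((geo9Y x).len y₁ ^ (1 - α) * cζ * Real.exp (-(δc * (geo9Y x).dist y₁ y'')) * M) := mul_le_mul_of_nonneg_right hle hfac
          _ = _ := by ring
      · exact hbinr ν' y'' μ M hμ
    -- (5) premise (c′) and the conclusion of the right transfer
    have concl := HR D' hmaj Φ y₁ (w₀, j₀) hp₀ α BhR cζ hBhR0 hcζ0 prema premb (fun y'' μ M hμ => by rw [hD']; exact hbinr ν y'' μ M hμ)
      yL (coordEquiv b (liftY f (E : 𝔸))) _ (hBS hE1)
    calc quotS x.toKIdx (parH U) α (wordS x.toKIdx ζ₀ (TW ∘ₗ cdsSL x.toKIdx U ν) (liftY f (E : 𝔸))) z z'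
        = ‖Φ ((coordEquiv b).symm ((GopC x.toKIdx parA b ((codingYx P G x C37 C38).bg.mul (.mult a) (.base U)) * D')
            (coordEquiv b (liftY f (E : 𝔸)))))‖ := by
          rw [quotS_wordS_eq, hD'U, hGopW, symm_G_negGradB, LinearEquiv.symm_apply_apply, map_neg, norm_neg]; rfl
      _ ≤ _ := concl
  ------------------------------------------------------------------
  -- WRITE the (3.43) block of the reading at the product
  ------------------------------------------------------------------
  have hfacN : 0 ≤ (geo9Y x).len y ^ (1 - α) * cζ * Real.exp (-(9 / 10 * δc * (geo9Y x).dist y y')) * (geo9Y x).supNorm (Sum.inl f) :=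
    mul_nonneg (mul_nonneg (mul_nonneg (Real.rpow_nonneg hleny.le _) hcζ0) (Real.exp_pos _).le) hsupN
  have hfinal : ∀ {Bside Bh : ℝ}, 0 ≤ Bside → 0 ≤ Bh → M₂ * (Bside * Bh) ≤ wH5 (2 * ((d : ℝ) + 1)) Sb M₂ cR cLip mN B₀ BL BR δc Bβ α →
      Bside * Bh * (geo9Y x).len y₁ ^ (1 - α) * cζ * Real.exp (-(9 / 10 * δc * (geo9Y x).dist y₁ yL)) * (M₂ * (geo9Y x).supNorm (Sum.inl f)) ≤
        wH5 (2 * ((d : ℝ) + 1)) Sb M₂ cR cLip mN B₀ BL BR δc Bβ α * (geo9Y x).len y ^ (1 - α) * (geo9Y x).cutH α (Sum.inl ζ₀) *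
          Real.exp (-(9 / 10 * δc * (geo9Y x).dist y y')) * (geo9Y x).supNorm (Sum.inl f) := by
    intro Bside Bh hBs hBh hle
    rw [hlen, hdistL, ← hcζ]
    calc Bside * Bh * (geo9Y x).len y ^ (1 - α) * cζ * Real.exp (-(9 / 10 * δc * (geo9Y x).dist y y')) * (M₂ * (geo9Y x).supNorm (Sum.inl f))
        = (M₂ * (Bside * Bh)) * ((geo9Y x).len y ^ (1 - α) * cζ * Real.exp (-(9 / 10 * δc * (geo9Y x).dist y y')) * (geo9Y x).supNorm (Sum.inl f)) := by
          ring
      _ ≤ wH5 (2 * ((d : ℝ) + 1)) Sb M₂ cR cLip mN B₀ BL BR δc Bβ α *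
            ((geo9Y x).len y ^ (1 - α) * cζ * Real.exp (-(9 / 10 * δc * (geo9Y x).dist y y')) * (geo9Y x).supNorm (Sum.inl f)) :=
          mul_le_mul_of_nonneg_right hle hfacN
      _ = _ := by ring
  have hwL : M₂ * (BL * BhL) ≤ wH5 (2 * ((d : ℝ) + 1)) Sb M₂ cR cLip mN B₀ BL BR δc Bβ α := by
    show M₂ * (BL * (Sb * Bp)) ≤ M₂ * (BL * (Sb * max (Bβ α) 0) + BR * (Sb * (cR * B₀ * (1 + cLip) + max (Bβ α) 0 *
      (1 + (mN : ℝ) * (M₂ * Sb) * Real.exp (δc * (2 * ((d : ℝ) + 1)))))))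
    rw [← hBp]
    exact mul_le_mul_of_nonneg_left (le_add_of_nonneg_right (by positivity)) hM₂
  have hwR : M₂ * (BR * BhR) ≤ wH5 (2 * ((d : ℝ) + 1)) Sb M₂ cR cLip mN B₀ BL BR δc Bβ α := by
    show M₂ * (BR * BhR) ≤ M₂ * (BL * (Sb * max (Bβ α) 0) + BR * (Sb * (cR * B₀ * (1 + cLip) + max (Bβ α) 0 *
      (1 + (mN : ℝ) * (M₂ * Sb) * Real.exp (δc * (2 * ((d : ℝ) + 1)))))))
    rw [← hBp, ← hBhR]
    exact mul_le_mul_of_nonneg_left (le_add_of_nonneg_left (by positivity)) hM₂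
  exact h1ReadT_le_of_probes x.toKIdx TW (parH U) U f α ζ₀ hRHS
    (fun E ν z z' hne => (hLeft E ν z z' hne).trans (hfinal hBL hBhL0 hwL))
    (fun E ν z z' hne => (hRight E ν z z' hne).trans (hfinal hBR hBhR0 hwR))

end Transfer

/-! ## §2 ★★ The frame instance over the coded carriers of a subfamily and the (3.43) block-steps -/

section Steps

variable [NormOneClass 𝔸] {J : Type} (f : J → MemberY d ℓ hd hL b₀ b₁ Mstar) [∀ x : MemberY d ℓ hd hL b₀ b₁ Mstar, Fintype (geo9Y x).Site]
  [instDS : ∀ x : MemberY d ℓ hd hL b₀ b₁ Mstar, DecidableEq (geo9Y x).Site] [instNE : ∀ x : MemberY d ℓ hd hL b₀ b₁ Mstar, Nonempty (geo9Y x).Site]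
  (c35 : ℝ) (G : Subgroup 𝔸ˣ) (parA parH : ∀ j : J, SiteParY 𝔸 (f j).toKIdx) (OA : ∀ j : J, BondOpY 𝔸 (f j).toKIdx)
  (parB : ∀ j : J, BondParY 𝔸 (f j).toKIdx) {ι : Type} [Fintype ι] [DecidableEq ι] (b : Module.Basis ι ℝ 𝔸)
  (ιB : ∀ j : J, BlkY (f j).toKIdx → IBondY (f j).toKIdx)
  (C37 C38 : ∀ j : J, ℝ → CfgY 𝔸 (f j).toKIdx → AfldY 𝔸 (f j).toKIdx → Prop)
  (Cinv : ∀ j : J, B9.SiteKernel (geo9Y (f j)) (bg9YC 𝔸 G P (f j)))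

/-- ★★ **THE (3.43) FRAME OVER THE CODED CARRIERS OF A SUBFAMILY, INHABITED FOR `KSC₇Par parA parH`**: the root frame `gpFrame₂CodedOn` AT `parA` (dictionaries
`read342Y_KSC₇Par ∕ write342Y_KSC₇Par`, reading constant `c_R = M₂Σ‖b_j‖`; laws `hpar hunit hC37` at `parA`), the writing function `wH5`, `wHδ δc = 9δc∕10`, and the
transfer field `h1_transfer_KSC₇Par` (laws `hparH`, `hLip` at `parH`).  Displayed beyond
the root frame's data: the transporter law `hLip` (`Reg335 ⇒ HolderLipY c_Lip (parH U) U`) and the neighbour count `hnbr` above the frame's threshold `MInv`.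
[cite: Balaban1985BackgroundPropagators, Thm 3.4 p.400, (3.43) p.398, p.403 l.1–9, (3.60)–(3.65) pp.402–403; Balaban1984PropagatorsII, Lemma 2.1 p.234, (2.51)–(2.52) p.232] -/
noncomputable def h1Frame₃CodedOnPar (hι : ∀ (j : J) (s : BlkY (f j).toKIdx), β (f j).toKIdx.hN (f j).toKIdx.D (f j).toKIdx.hk (ιB j s) = s)
    (hG1 : ∀ u : 𝔸ˣ, u ∈ G → ‖(u : 𝔸)‖ ≤ 1) (hpar : ∀ j (U : CfgY 𝔸 (f j).toKIdx), GVal G (f j).toKIdx U → ∀ z w, parA j U z w ∈ G)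
    (hparH : ∀ j (U : CfgY 𝔸 (f j).toKIdx), GVal G (f j).toKIdx U → ∀ z w, parH j U z w ∈ G)
    (hunit : ∀ j (U : CfgY 𝔸 (f j).toKIdx), GVal G (f j).toKIdx U → IsUnit (deltaPrimeAY (f j).toKIdx (parA j) U))
    (dB : ℕ) (M₂ : ℝ) (hM₂ : 0 ≤ M₂) (hrepr : ∀ (v : 𝔸) (j : ι), |b.repr v j| ≤ M₂ * ‖v‖) (hcR : 0 < M₂ * ∑ j, ‖b j‖)
    (Cq : ℝ) (hCq : 0 ≤ Cq) (hC37 : ∀ j β' U a, C37 j β' U a → GVal G (f j).toKIdx U ∧ CplxLettersY G (f j) (parA j) (ιB j) Cq β' U a)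
    (MInv aInv aW : ℝ) (hMInv : 0 < MInv) (haInv : 0 < aInv) (haW : 0 < aW)
    {cLip : ℝ} (hcLip : 0 ≤ cLip)
    (hLip : ∀ (j : J) (α₀ : ℝ) (U : CfgY 𝔸 (f j).toKIdx), (bg9YC 𝔸 G P (f j)).Reg335 c35 α₀ U → HolderLipY (f j).toKIdx cLip (parH j U) U)
    {mN : ℕ} (hnbr : ∀ j : J, MInv ≤ (geo9Y (f j)).M → ∀ y' : IBondY (f j).toKIdx, (nbr (geo9Y (f j)) (2 * ((d : ℝ) + 1)) y').card ≤ mN) :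
    H1Frame₃ c35 (fun j => geo9Y (f j)) (fun j => (codingYx P G (f j) (C37 j) (C38 j)).bg) (fun j => KSC₇Par P G (f j) (parA j) (parH j) (C37 j) (C38 j)) b
      (Fin (d + 1)) (fun j => SiteY (f j).toKIdx) :=
  { gpFrame₂CodedOn P f c35 G b C37 C38 parA ιB (fun j => KSC₇Par P G (f j) (parA j) (parH j) (C37 j) (C38 j)) hι hG1 hpar hunit dB M₂ hM₂ hrepr Cq hCq hC37
      (M₂ * ∑ j, ‖b j‖) hcR (fun B _ => (M₂ * ∑ j, ‖b j‖) * B + 1) (fun B _ hB _ => by positivity) (fun δ => δ) (fun δ hδ => hδ)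
      MInv aInv aW hMInv haInv haW (fun j => read342Y_KSC₇Par P G (f j) (parA j) (parH j) b (ιB j) (C37 j) (C38 j) (hι j) M₂ hM₂ hrepr c35 MInv aInv)
      (fun j => write342Y_KSC₇Par P G (f j) (parA j) (parH j) b (ιB j) (C37 j) (C38 j) (hι j) M₂ hM₂ hrepr aW fun β' U a h => (hC37 j β' U a h).1) with
    wH := fun B₀ BL BR δc Bβ => wH5 (2 * ((d : ℝ) + 1)) (∑ j, ‖b j‖) M₂ (M₂ * ∑ j, ‖b j‖) cLip mN B₀ BL BR δc Bβ
    wHδ := fun δc => 9 / 10 * δc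
    wHδ_pos := fun δc hδc => by positivity
    h1_transfer := fun j α₀ c c' α₁ B₀ BL BR δ δc Bβ hM hα₀ hMa hreg hα₁ haW' h37 hB₀ hBL hBR hδ hδc hδcδ hE hH1 HL HR =>
      h1_transfer_KSC₇Par P c35 G (f j) (parA j) (parH j) b (ιB j) (C37 j) (C38 j) (hι j) hG1 (hparH j) hM₂ hrepr hcLip (hLip j) (hnbr j) hcR
        (read342Y_KSC₇Par P G (f j) (parA j) (parH j) b (ιB j) (C37 j) (C38 j) (hι j) M₂ hM₂ hrepr c35 MInv aInv)
        α₀ c c' α₁ B₀ BL BR δ δc Bβ hM hα₀ hMa hreg hα₁ haW' h37 hB₀ hBL hBR hδ hδc hδcδ hE hH1 HL HR }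

/-- ★★ **`StepH1Pos` OF `KSC₇Par parA parH` OVER THE CODED CARRIERS** (any shared `GA`, `Cinv` over the coded background): `stepH1Pos_of_h1Frame₃` on `h1Frame₃CodedOnPar`.
[cite: Balaban1985BackgroundPropagators, Thm 3.4 p.400, Thm 3.1 (3.43) p.398, (3.60)–(3.65) pp.402–403; Balaban1984PropagatorsII, Lemma 2.1 p.234] -/
theorem stepH1Pos_KSC₇Par_on (hι : ∀ (j : J) (s : BlkY (f j).toKIdx), β (f j).toKIdx.hN (f j).toKIdx.D (f j).toKIdx.hk (ιB j s) = s)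
    (hG1 : ∀ u : 𝔸ˣ, u ∈ G → ‖(u : 𝔸)‖ ≤ 1) (hpar : ∀ j (U : CfgY 𝔸 (f j).toKIdx), GVal G (f j).toKIdx U → ∀ z w, parA j U z w ∈ G)
    (hparH : ∀ j (U : CfgY 𝔸 (f j).toKIdx), GVal G (f j).toKIdx U → ∀ z w, parH j U z w ∈ G)
    (hunit : ∀ j (U : CfgY 𝔸 (f j).toKIdx), GVal G (f j).toKIdx U → IsUnit (deltaPrimeAY (f j).toKIdx (parA j) U))
    (dB : ℕ) (M₂ : ℝ) (hM₂ : 0 ≤ M₂) (hrepr : ∀ (v : 𝔸) (j : ι), |b.repr v j| ≤ M₂ * ‖v‖) (hcR : 0 < M₂ * ∑ j, ‖b j‖)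
    (Cq : ℝ) (hCq : 0 ≤ Cq) (hC37 : ∀ j β' U a, C37 j β' U a → GVal G (f j).toKIdx U ∧ CplxLettersY G (f j) (parA j) (ιB j) Cq β' U a)
    (MInv aInv aW : ℝ) (hMInv : 0 < MInv) (haInv : 0 < aInv) (haW : 0 < aW)
    {cLip : ℝ} (hcLip : 0 ≤ cLip)
    (hLip : ∀ (j : J) (α₀ : ℝ) (U : CfgY 𝔸 (f j).toKIdx), (bg9YC 𝔸 G P (f j)).Reg335 c35 α₀ U → HolderLipY (f j).toKIdx cLip (parH j U) U)
    {mN : ℕ} (hnbr : ∀ j : J, MInv ≤ (geo9Y (f j)).M → ∀ y' : IBondY (f j).toKIdx, (nbr (geo9Y (f j)) (2 * ((d : ℝ) + 1)) y').card ≤ mN)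
    (GA : ∀ j : J, B9.KernelFamily (geo9Y (f j)) (codingYx P G (f j) (C37 j) (C38 j)).bg)
    (CinvC : ∀ j : J, B9.SiteKernel (geo9Y (f j)) (codingYx P G (f j) (C37 j) (C38 j)).bg) :
    StepH1Pos dB c35 (fun j => geo9Y (f j)) (fun j => (codingYx P G (f j) (C37 j) (C38 j)).bg) (fun j => KSC₇Par P G (f j) (parA j) (parH j) (C37 j) (C38 j)) GA CinvC
      (fun j => KSC₇Par P G (f j) (parA j) (parH j) (C37 j) (C38 j)) :=
  stepH1Pos_of_h1Frame₃ (d := dB)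
    (h1Frame₃CodedOnPar P f c35 G parA parH b ιB C37 C38 hι hG1 hpar hparH hunit dB M₂ hM₂ hrepr hcR Cq hCq hC37 MInv aInv aW hMInv haInv haW hcLip hLip hnbr) GA CinvC

/-- ★★★ **`StepH1Pos` OF THE TWO-TRANSPORTER READING OVER THE CODED CARRIER — THE (3.43) MEMBER OF THE SECT.-B STEP OF RECORD FOR `(KSCUPar parA parH, KACU, C⁻¹)`**
(input families `(KSCUPar, KACU, pullS Cinv)`, output `KSCUPar`'s (3.43) block at the product): `stepH1Pos_KSC₇Par_on` (with `GA := KACU`, `Cinv := pullS Cinv`)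
transported by `stepH1Pos_of_family_pos` — `hin_KSCUPar_on_pos`, identity output (`KSC₇Par.h1 = KSCUPar.h1`).  The neighbour count is taken above its own threshold
(`exists_card_nbr_geo9Y_le_of_M`, folded into the frame's `MInv`).  DISPLAYED beyond `B9SectBCodedFamiliesUParH.stepEPos_KSCUPar_on`'s data (laws `hpar hunit hC37`
at the AVERAGING transporter `parA`): `hparH` (the HÖLDER transporters take values in `G`) and the transporter law `hLip` (`Reg335 ⇒ HolderLipY c_Lip (parH U) U`).
[cite: Balaban1985BackgroundPropagators, Thm 3.4 p.400, Thm 3.1 (3.43) p.398, (3.40) p.397, (3.21) p.394, p.403 l.1–9, (3.60)–(3.65) pp.402–403, (3.35)–(3.37) p.396; Balaban1984PropagatorsII, Lemma 2.1 p.234, (2.51)–(2.52) p.232] -/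
theorem stepH1Pos_KSCUPar_on (hι : ∀ (j : J) (s : BlkY (f j).toKIdx), β (f j).toKIdx.hN (f j).toKIdx.D (f j).toKIdx.hk (ιB j s) = s)
    (hG1 : ∀ u : 𝔸ˣ, u ∈ G → ‖(u : 𝔸)‖ ≤ 1) (hpar : ∀ j (U : CfgY 𝔸 (f j).toKIdx), GVal G (f j).toKIdx U → ∀ z w, parA j U z w ∈ G)
    (hparH : ∀ j (U : CfgY 𝔸 (f j).toKIdx), GVal G (f j).toKIdx U → ∀ z w, parH j U z w ∈ G)
    (hunit : ∀ j (U : CfgY 𝔸 (f j).toKIdx), GVal G (f j).toKIdx U → IsUnit (deltaPrimeAY (f j).toKIdx (parA j) U))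
    (dB : ℕ) (M₂ : ℝ) (hM₂ : 0 ≤ M₂) (hrepr : ∀ (v : 𝔸) (j : ι), |b.repr v j| ≤ M₂ * ‖v‖) (hcR : 0 < M₂ * ∑ j, ‖b j‖)
    (Cq : ℝ) (hCq : 0 ≤ Cq) (hC37 : ∀ j β' U a, C37 j β' U a → GVal G (f j).toKIdx U ∧ CplxLettersY G (f j) (parA j) (ιB j) Cq β' U a)
    (MInv aInv aW : ℝ) (hMInv : 0 < MInv) (haInv : 0 < aInv) (haW : 0 < aW)
    {cLip : ℝ} (hcLip : 0 ≤ cLip)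
    (hLip : ∀ (j : J) (α₀ : ℝ) (U : CfgY 𝔸 (f j).toKIdx), (bg9YC 𝔸 G P (f j)).Reg335 c35 α₀ U → HolderLipY (f j).toKIdx cLip (parH j U) U) :
    StepH1Pos dB c35 (fun j => geo9Y (f j)) (fun j => (codingYx P G (f j) (C37 j) (C38 j)).bg)
      (fun j => KSCUPar P G (f j) (parA j) (parH j) (C37 j) (C38 j)) (fun j => KACU P G (f j) (OA j) (parB j) (C37 j) (C38 j))
      (fun j => pullS (codingYx P G (f j) (C37 j) (C38 j)) (Cinv j)) (fun j => KSCUPar P G (f j) (parA j) (parH j) (C37 j) (C38 j)) := by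
  obtain ⟨ML, mN, hcnt⟩ := exists_card_nbr_geo9Y_le_of_M (d := d) (ℓ := ℓ) (hd := hd) (hL := hL) (b₀ := b₀) (b₁ := b₁) (2 * ((d : ℝ) + 1))
  have hMInv' : 0 < max MInv ML := lt_max_of_lt_left hMInv
  have hnbr : ∀ j : J, max MInv ML ≤ (geo9Y (f j)).M → ∀ y' : IBondY (f j).toKIdx, (nbr (geo9Y (f j)) (2 * ((d : ℝ) + 1)) y').card ≤ mN :=
    fun j hM y' => hcnt Mstar (f j) (le_trans (le_max_right _ _) hM) y'
  refine stepH1Pos_of_family_pos dB c35 (fun j => geo9Y (f j)) (fun j => (codingYx P G (f j) (C37 j) (C38 j)).bg)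
    (fun j => KSC₇Par P G (f j) (parA j) (parH j) (C37 j) (C38 j)) (fun j => KSCUPar P G (f j) (parA j) (parH j) (C37 j) (C38 j))
    (fun j => KACU P G (f j) (OA j) (parB j) (C37 j) (C38 j)) (fun j => KACU P G (f j) (OA j) (parB j) (C37 j) (C38 j))
    (fun j => pullS (codingYx P G (f j) (C37 j) (C38 j)) (Cinv j))
    (fun j => KSC₇Par P G (f j) (parA j) (parH j) (C37 j) (C38 j)) (fun j => KSCUPar P G (f j) (parA j) (parH j) (C37 j) (C38 j))
    (hin_KSCUPar_on_pos P f c35 G parA parH OA parB b ιB C37 C38 Cinv hι hG1 hM₂ hrepr dB)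
    (fun Bβ δ a hδ ha => ⟨0, 1, a, Bβ, δ, one_pos, ha, le_rfl, hδ,
      fun j _ _ _ _ _ _ _ _ _ _ _ h => (h1Block_KSC₇Par_iff P G (f j) (parA j) (parH j) (C37 j) (C38 j) _).1 h⟩)
    (stepH1Pos_KSC₇Par_on P f c35 G parA parH b ιB C37 C38 hι hG1 hpar hparH hunit dB M₂ hM₂ hrepr hcR Cq hCq hC37 (max MInv ML) aInv aW hMInv' haInv
      haW hcLip hLip hnbr _ _)

/-! ## §3 The Hölder transporter of record: `parH := parSymY` (print's shortest contours), laws discharged -/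

/-- ★★ **`StepH1Pos` OF `(KSCUPar parA parSymY, KACU, C⁻¹)` — THE HÖLDER TRANSPORTER OF RECORD, ITS TWO LAWS DISCHARGED**: `stepH1Pos_KSCUPar_on` at
`parH j := parSymY (f j).toKIdx` with `hparH := Node00.parSymY_mem` and `hLip := hLip_parSymY` (`c_Lip = d+1`); the AVERAGING transporter `parA` is a parameter with
its laws `hpar hunit hC37` displayed (at the knit instance `parA := parKnitY` they are dag-n06-l's K2 lemmas).  Binders = those of
`B9SectBCodedFamiliesUParH.stepEPos_KSCUPar_on`. [cite: Balaban1985BackgroundPropagators, Thm 3.4 p.400, Thm 3.1 (3.43) p.398, (3.40) p.397 («a shortest contour»), (3.21) p.394, p.403 l.1–9, (3.35)–(3.37) p.396; Balaban1984PropagatorsII, Lemma 2.1 p.234, (2.51)–(2.52) p.232] -/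
theorem stepH1Pos_KSCUPar_parSymYH_on (hι : ∀ (j : J) (s : BlkY (f j).toKIdx), β (f j).toKIdx.hN (f j).toKIdx.D (f j).toKIdx.hk (ιB j s) = s)
    (hG1 : ∀ u : 𝔸ˣ, u ∈ G → ‖(u : 𝔸)‖ ≤ 1) (hpar : ∀ j (U : CfgY 𝔸 (f j).toKIdx), GVal G (f j).toKIdx U → ∀ z w, parA j U z w ∈ G)
    (hunit : ∀ j (U : CfgY 𝔸 (f j).toKIdx), GVal G (f j).toKIdx U → IsUnit (deltaPrimeAY (f j).toKIdx (parA j) U))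
    (dB : ℕ) (M₂ : ℝ) (hM₂ : 0 ≤ M₂) (hrepr : ∀ (v : 𝔸) (j : ι), |b.repr v j| ≤ M₂ * ‖v‖) (hcR : 0 < M₂ * ∑ j, ‖b j‖)
    (Cq : ℝ) (hCq : 0 ≤ Cq) (hC37 : ∀ j β' U a, C37 j β' U a → GVal G (f j).toKIdx U ∧ CplxLettersY G (f j) (parA j) (ιB j) Cq β' U a)
    (MInv aInv aW : ℝ) (hMInv : 0 < MInv) (haInv : 0 < aInv) (haW : 0 < aW) :
    StepH1Pos dB c35 (fun j => geo9Y (f j)) (fun j => (codingYx P G (f j) (C37 j) (C38 j)).bg)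
      (fun j => KSCUPar P G (f j) (parA j) (parSymY (f j).toKIdx) (C37 j) (C38 j)) (fun j => KACU P G (f j) (OA j) (parB j) (C37 j) (C38 j))
      (fun j => pullS (codingYx P G (f j) (C37 j) (C38 j)) (Cinv j))
      (fun j => KSCUPar P G (f j) (parA j) (parSymY (f j).toKIdx) (C37 j) (C38 j)) :=
  stepH1Pos_KSCUPar_on P f c35 G parA (fun j => parSymY (f j).toKIdx) OA parB b ιB C37 C38 Cinv hι hG1 hpar (fun j _ hU z w => parSymY_mem (f j).toKIdx hU z w) hunit dB M₂
    hM₂ hrepr hcR Cq hCq hC37 MInv aInv aW hMInv haInv haW (by positivity : (0 : ℝ) ≤ (d : ℝ) + 1) (hLip_parSymY P f c35 G hG1)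

end Steps

end Literature.MathematicalPhysics.QuantumFieldTheory.Balaban1983to89.B9SectBH1StepUParH

end
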